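import Summits.CriticalPhenomena.PercolationContinuityZ3.Theorems.PercNearOneGluingNoHeavyLowerTailHullPortGluedStar
import Summits.CriticalPhenomena.PercolationContinuityZ3.Theorems.PercNearOneGluingNoHeavyLowerTailHullPortLSLofSP
import HarnessLib

/-!
# `NoHeavyLowerTail` (stmt-CriticalPhenomena-4575) — hull-port line: the two-block scenario statement (T⁻)_σ modulo (SP)

Support file (prover `prim-hp-7`; `--supports stmt-CriticalPhenomena-4575`); no definitions, named facts or sorries.
Composition of `HullPort.threeCluster_scenario_of_LSL` (prim-hp-1: (T⁻)_σ for the `b`-selected piece of `U = C(x₁) ∪ C(x₂)` in the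
two-block scenario graph, MODULO the localized selection lemma LSL) with `HullPort.lsl_of_sp` (this seat: LSL follows from the
"mirror worlds" marker inequality (SP) by bookkeeping).  Result: in the scenario graph `u = K[s(x_i,t) ↦ 1, t ∈ T_i]`, if `z`
dominates every port `t ∈ T₁ ∪ T₂` in `K`-loneliness and (SP) holds for `μ_u` and the marker `b`, then
`μ_u(z ∉ U, Ψ_b) ≤ μ_u(z ∉ U, R_z)` — the scenario form (T⁻)_σ of the crux memo HULLPORT-COUPLING.md §11/§17/§20 now rests on the
single census-clean inequality (SP) (seat memo run/shared/lean/prim/prim-hp-7/HP7-GX-FAMILY.md §2b–2c; (SP) is NOT proved here).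
[cite: VandenbergHaggstromKahn2005, Thm. 1.5 (p. 7) — via `threeCluster_scenario_of_LSL`]
-/

noncomputable section

namespace Summit.CriticalPhenomena.PercolationContinuityZ3.Theorems

open MeasureTheory Set Literature.Probability.LatticeModels Literature.Probability.Percolation
open scoped Classical

variable {n : ℕ}

namespace HullPort

/-- **(T⁻)_σ modulo (SP).**  Hypotheses as in `threeCluster_scenario_of_LSL`, with its `hLSL` replaced by the mirror-worlds
marker inequality (SP) for the scenario weights `u` (`G₋ = {x₁ light, x₂ heavy}`, `G₊` the mirror, inside
`D' = {z ∉ U} ∩ {x₁ ↮ x₂}`); conclusion: the `b`-selected piece of `U` is light on `{z ∉ U}` with probability at most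
`μ_u(z ∉ U, R_z)`. [this file] -/
theorem threeCluster_scenario_of_sp (K : Sym2 (Fin n) → unitInterval) (A : Finset (Fin n)) (x₁ x₂ z b : Fin n) (j : ℕ)
    (hx : x₁ ≠ x₂) (hz₁ : z ≠ x₁) (hz₂ : z ≠ x₂) (T₁ T₂ : Finset (Fin n))
    (h₁ : x₁ ∉ T₁) (h₂ : x₂ ∉ T₂) (h₂₁ : x₂ ∉ T₁) (hzT₁ : z ∉ T₁) (hzT₂ : z ∉ T₂)
    (hT₁ : T₁.Nonempty) (hT₂ : T₂.Nonempty)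
    (hK₁ : ∀ t ∈ T₁, K s(x₁, t) = 0) (hK₂ : ∀ t ∈ T₂, K s(x₂, t) = 0)
    (hdom : ∀ t ∈ T₁ ∪ T₂,
      (prodBernoulli K).real {ω : BondConfig (Fin n) | (A.filter fun q => ω ∈ openConn t q).card ≤ j} ≤
        (prodBernoulli K).real {ω : BondConfig (Fin n) | (A.filter fun q => ω ∈ openConn z q).card ≤ j})
    (hSP : (prodBernoulli (fun e => if ∃ t ∈ T₂, e = s(x₂, t) then 1 else if ∃ t ∈ T₁, e = s(x₁, t) then 1 else K e)).real
          {ω : BondConfig (Fin n) | (¬ (openGraph ω).Reachable z x₁ ∧ ¬ (openGraph ω).Reachable z x₂ ∧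
            ¬ (openGraph ω).Reachable x₁ x₂) ∧ ((A.filter fun q => ω ∈ openConn x₁ q).card ≤ j ∧
            j < (A.filter fun q => ω ∈ openConn x₂ q).card) ∧ (openGraph ω).Reachable x₁ b} *
        (prodBernoulli (fun e => if ∃ t ∈ T₂, e = s(x₂, t) then 1 else if ∃ t ∈ T₁, e = s(x₁, t) then 1 else K e)).real
          {ω : BondConfig (Fin n) | (¬ (openGraph ω).Reachable z x₁ ∧ ¬ (openGraph ω).Reachable z x₂ ∧
            ¬ (openGraph ω).Reachable x₁ x₂) ∧ ((A.filter fun q => ω ∈ openConn x₂ q).card ≤ j ∧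
            j < (A.filter fun q => ω ∈ openConn x₁ q).card) ∧ (openGraph ω).Reachable x₂ b} ≤
      (prodBernoulli (fun e => if ∃ t ∈ T₂, e = s(x₂, t) then 1 else if ∃ t ∈ T₁, e = s(x₁, t) then 1 else K e)).real
          {ω : BondConfig (Fin n) | (¬ (openGraph ω).Reachable z x₁ ∧ ¬ (openGraph ω).Reachable z x₂ ∧
            ¬ (openGraph ω).Reachable x₁ x₂) ∧ ((A.filter fun q => ω ∈ openConn x₁ q).card ≤ j ∧
            j < (A.filter fun q => ω ∈ openConn x₂ q).card) ∧ ¬ (openGraph ω).Reachable x₁ b} *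
        (prodBernoulli (fun e => if ∃ t ∈ T₂, e = s(x₂, t) then 1 else if ∃ t ∈ T₁, e = s(x₁, t) then 1 else K e)).real
          {ω : BondConfig (Fin n) | (¬ (openGraph ω).Reachable z x₁ ∧ ¬ (openGraph ω).Reachable z x₂ ∧
            ¬ (openGraph ω).Reachable x₁ x₂) ∧ ((A.filter fun q => ω ∈ openConn x₂ q).card ≤ j ∧
            j < (A.filter fun q => ω ∈ openConn x₁ q).card) ∧ ¬ (openGraph ω).Reachable x₂ b}) :
    (prodBernoulli (fun e => if ∃ t ∈ T₂, e = s(x₂, t) then 1 else if ∃ t ∈ T₁, e = s(x₁, t) then 1 else K e)).real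
        ({ω : BondConfig (Fin n) | ¬ (openGraph ω).Reachable z x₁ ∧ ¬ (openGraph ω).Reachable z x₂} ∩
          {ω : BondConfig (Fin n) | ((ω ∈ openConn x₁ b ∨ ω ∈ openConn x₂ b) ∧
              (A.filter fun t => ω ∈ openConn b t).card ≤ j) ∨
            (ω ∉ openConn x₁ b ∧ ω ∉ openConn x₂ b ∧
              (A.filter fun t => ω ∈ openConn x₁ t ∨ ω ∈ openConn x₂ t).card ≤ j)}) ≤
      (prodBernoulli (fun e => if ∃ t ∈ T₂, e = s(x₂, t) then 1 else if ∃ t ∈ T₁, e = s(x₁, t) then 1 else K e)).real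
        {ω : BondConfig (Fin n) | ¬ (openGraph ω).Reachable z x₁ ∧ ¬ (openGraph ω).Reachable z x₂ ∧
          (A.filter fun q => ω ∈ openConn z q).card ≤ j} :=
  threeCluster_scenario_of_LSL K A x₁ x₂ z j hx hz₁ hz₂ T₁ T₂ h₁ h₂ h₂₁ hzT₁ hzT₂ hT₁ hT₂ hK₁ hK₂ hdom _
    (lsl_of_sp _ A x₁ x₂ z b j hSP)

end HullPort

end Summit.CriticalPhenomena.PercolationContinuityZ3.Theorems
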